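import Literature.MathematicalPhysics.QuantumLattice.StaggeredPeriodicAntiperiodicEquivalence
import Literature.MathematicalPhysics.QuantumFieldTheory.LatticeGaugeProofs
import HarnessLib

/-!
# Translation invariance of the staggered two-point function at every coupling (the staggered
# shift symmetry of the periodic `U(N)` theory on the even torus)

[abstract] The one-component staggered action `∑_{x,μ} ½η_μ(x)[ψ̄(x)U_{x,μ}ψ(x+e_μ) - ψ̄(x+e_μ)U_{x,μ}⁻¹ψ(x)]`
is not invariant under a bare lattice translation `x ↦ x + c` (the phases `η_μ(x) = (-1)^{x_1+⋯+x_{μ-1}}`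
change by the signs `η_μ(c)`), but on an EVEN torus it is invariant under the translation combined with
the site-dependent sign `ψ(x) ↦ ζ_c(x)ψ(x)`, `ψ̄(x) ↦ ζ_c(x)ψ̄(x)`, `ζ_c(x) = ∏_μ η_μ(c)^{x_μ}`
(`ζ_c(x)ζ_c(x+e_μ) = η_μ(c)`): the staggered "shift symmetry" (Montvay–Münster §4.3, (4.186)–(4.187);
Salmhofer–Seiler (2.3)–(2.4)).  At the level of the massless Dirac matrix `D₀[U]`
(`staggeredDirac`, periodic, defining representation of `U(N)`) this reads
`D₀[τ_c U] = P_c (S_c D₀[U] S_c) P_c⁻¹` (`D0_torusConfigShift`), `τ_c U(x,μ) = U(x-c,μ)` the tree's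
`torusConfigShift`, `S_c = diag ζ_c`, `P_c` the relabelling `(x,a) ↦ (x+c,a)`; hence
`det D₀[τ_c U] = det D₀[U]` and the Wick contraction of `ψ̄ψ(x+c)ψ̄ψ(y+c)` with `D₀[τ_cU]⁻¹` equals that
of `ψ̄ψ(x)ψ̄ψ(y)` with `D₀[U]⁻¹` (`wick2_inv_D0_torusConfigShift`; the signs square away).  Since the
Wilson weight `e^{-βS_W}∏dU` is translation invariant at every `β` (`wilsonWeight_map_torusConfigShift`),
the determinant ∕ propagator representation of the two-point function — the object of the venture's
typed conjecture `SalmhoferSeilerSmallBeta` — is TRANSLATION INVARIANT and SYMMETRIC at every real `β`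
(`detRep_twoPoint_add`, `detRep_twoPoint_comm`): it is a kernel `T_β(x - y)` on the torus, the form in
which the infrared-bound argument (Salmhofer–Seiler (3.100)–(3.113)) addresses it.

[scope] Finite even torus, periodic b.c., `G = U(N)` (any `N`), `m = 0`, every real `β`; exact
identities.  No claim about `β > 0` physics, the continuum or the summit's `QCD` conjunct.  One
definition (`shiftSign`, the sign `ζ_c`); theorems otherwise; no facts, no `sorry`.

## References
* [SalmhoferSeiler1991] M. Salmhofer, E. Seiler, Commun. Math. Phys. 139 (1991) 395–432, §2 (2.3)–(2.4),
  (2.9)–(2.12); (3.100) (translation-invariant two-point function `T_Λ(x-y)`).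
* [MontvayMunster1994] I. Montvay, G. Münster, Quantum Fields on a Lattice, CUP 1994, §4.3
  (4.186)–(4.187) (shift symmetry of staggered fermions).
-/

noncomputable section

open MeasureTheory Matrix Complex Finset Filter
open Literature.MathematicalPhysics.QuantumFieldTheory
open Literature.MathematicalPhysics.QuantumFieldTheory.TorusTranslation (torusConfigShift torusConfigShift_apply torusEdgeShift)
open Literature.Probability.LatticeModels (TorusSite)
open scoped ComplexConjugate BigOperators

namespace Literature.MathematicalPhysics.QuantumLattice

namespace StaggeredShift

open StrongCoupling StaggeredSingular StaggeredRP

/-! ## 1. Parities on the even torus: the staggered phases are characters -/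

section Phase

variable {ν L : ℕ} [NeZero L]

/-- On `ℤ/Lℤ` with `L` even, `a ↦ u^{val a}` is multiplicative for every integer `u` with `u² = 1`. [cite: MontvayMunster1994, §4.3 (4.186)–(4.187)] -/
theorem int_pow_val_add (hL : Even L) {u : ℤ} (hu : u * u = 1) (a b : ZMod L) :
    u ^ (a + b).val = u ^ a.val * u ^ b.val := by
  have huL : u ^ L = 1 := by
    obtain ⟨k, hk⟩ := hL
    rw [hk, ← two_mul, pow_mul, sq, hu, one_pow]
  rw [← pow_add, ZMod.val_add]
  conv_rhs => rw [← Nat.mod_add_div (a.val + b.val) L, pow_add, pow_mul, huL, one_pow, mul_one]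

omit [NeZero L] in
/-- The staggered phase as an integer: `η_μ(x) = (-1)^{x_1 + ⋯ + x_{μ-1}}`. [cite: SalmhoferSeiler1991, §2 (2.4)] -/
theorem coe_staggeredPhase (x : TorusSite ν L) (μ : Fin ν) :
    ((staggeredPhase x μ : ℤˣ) : ℤ) = (-1 : ℤ) ^ (∑ j ∈ Finset.univ.filter (· < μ), (x j).val) := by
  unfold staggeredPhase
  rfl

omit [NeZero L] in
/-- `η_μ(x)² = 1`. [cite: SalmhoferSeiler1991, §2 (2.4)] -/
theorem coe_staggeredPhase_mul_self (x : TorusSite ν L) (μ : Fin ν) :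
    ((staggeredPhase x μ : ℤˣ) : ℤ) * ((staggeredPhase x μ : ℤˣ) : ℤ) = 1 := by
  rw [← Units.val_mul, Int.units_mul_self, Units.val_one]

/-- **The staggered phases are characters of the even torus**: `η_μ(x + c) = η_μ(x) η_μ(c)`. [cite: SalmhoferSeiler1991, §2 (2.4)] -/
theorem coe_staggeredPhase_add (hL : Even L) (x c : TorusSite ν L) (μ : Fin ν) :
    ((staggeredPhase (x + c) μ : ℤˣ) : ℤ) = ((staggeredPhase x μ : ℤˣ) : ℤ) * ((staggeredPhase c μ : ℤˣ) : ℤ) := by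
  rw [coe_staggeredPhase, coe_staggeredPhase, coe_staggeredPhase, ← Finset.prod_pow_eq_pow_sum,
    ← Finset.prod_pow_eq_pow_sum, ← Finset.prod_pow_eq_pow_sum, ← Finset.prod_mul_distrib]
  exact Finset.prod_congr rfl fun j _ => by rw [Pi.add_apply, int_pow_val_add hL (by norm_num)]

/-- **The shift sign** `ζ_c(x) = ∏_μ η_μ(c)^{x_μ} ∈ {±1}` compensating the change of the staggered
phases under the translation by `c` (`ζ_c(x) ζ_c(x + e_μ) = η_μ(c)`). [cite: MontvayMunster1994, §4.3 (4.186)–(4.187)] -/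
def shiftSign (c x : TorusSite ν L) : ℤ := ∏ μ : Fin ν, ((staggeredPhase c μ : ℤˣ) : ℤ) ^ (x μ).val

omit [NeZero L] in
/-- `ζ_c(x)² = 1`. [cite: MontvayMunster1994, §4.3 (4.186)–(4.187)] -/
theorem shiftSign_mul_self (c x : TorusSite ν L) : shiftSign c x * shiftSign c x = 1 := by
  unfold shiftSign
  rw [← Finset.prod_mul_distrib]
  exact Finset.prod_eq_one fun μ _ => by rw [← mul_pow, coe_staggeredPhase_mul_self, one_pow]

/-- `ζ_c(x + e_μ) = ζ_c(x) η_μ(c)` on the even torus. [cite: MontvayMunster1994, §4.3 (4.186)–(4.187)] -/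
theorem shiftSign_add_single (hL : Even L) (c x : TorusSite ν L) (μ : Fin ν) :
    shiftSign c (x + Pi.single μ 1) = shiftSign c x * ((staggeredPhase c μ : ℤˣ) : ℤ) := by
  classical
  unfold shiftSign
  rw [← Finset.mul_prod_erase _ _ (Finset.mem_univ μ), ← Finset.mul_prod_erase Finset.univ _ (Finset.mem_univ μ)]
  have hrest : (∏ j ∈ Finset.univ.erase μ,
      ((staggeredPhase c j : ℤˣ) : ℤ) ^ ((x + Pi.single μ (1 : ZMod L) : TorusSite ν L) j).val) =
      ∏ j ∈ Finset.univ.erase μ, ((staggeredPhase c j : ℤˣ) : ℤ) ^ (x j).val :=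
    Finset.prod_congr rfl fun j hj => by
      rw [Pi.add_apply, Pi.single_eq_of_ne (Finset.ne_of_mem_erase hj), add_zero]
  rw [hrest, Pi.add_apply, Pi.single_eq_same, int_pow_val_add hL (coe_staggeredPhase_mul_self c μ)]
  have h1 : (1 : ZMod L).val = 1 := by
    have hL2 : 2 ≤ L := by obtain ⟨k, hk⟩ := hL; have := NeZero.ne L; omega
    haveI : Fact (1 < L) := ⟨by omega⟩
    exact ZMod.val_one L
  rw [h1, pow_one]
  ring

omit [NeZero L] in
/-- `ζ_c(x)² = 1` as complex numbers. [cite: MontvayMunster1994, §4.3 (4.186)–(4.187)] -/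
theorem cast_shiftSign_mul_self (c x : TorusSite ν L) : ((shiftSign c x : ℤ) : ℂ) * ((shiftSign c x : ℤ) : ℂ) = 1 := by
  rw [← Int.cast_mul, shiftSign_mul_self, Int.cast_one]

/-- `η_μ(x + c) = ζ_c(x) ζ_c(x + e_μ) η_μ(x)` (the forward hop `x → x + e_μ`). [cite: MontvayMunster1994, §4.3 (4.186)–(4.187)] -/
theorem phase_add_eq_shiftSign_mul (hL : Even L) (c x : TorusSite ν L) (μ : Fin ν) :
    (((staggeredPhase (x + c) μ : ℤˣ) : ℤ) : ℂ) =
      ((shiftSign c x : ℤ) : ℂ) * ((shiftSign c (x + Pi.single μ 1) : ℤ) : ℂ) *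
        (((staggeredPhase x μ : ℤˣ) : ℤ) : ℂ) := by
  rw [shiftSign_add_single hL, coe_staggeredPhase_add hL]
  push_cast
  linear_combination (((staggeredPhase x μ : ℤˣ) : ℤ) : ℂ) * (((staggeredPhase c μ : ℤˣ) : ℤ) : ℂ) *
    (cast_shiftSign_mul_self c x).symm

/-- `η_μ(y + e_μ + c) = ζ_c(y + e_μ) ζ_c(y) η_μ(y + e_μ)` (the backward hop `y + e_μ → y`). [cite: MontvayMunster1994, §4.3 (4.186)–(4.187)] -/
theorem phase_shift_add_eq_shiftSign_mul (hL : Even L) (c y : TorusSite ν L) (μ : Fin ν) :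
    (((staggeredPhase (y + Pi.single μ 1 + c) μ : ℤˣ) : ℤ) : ℂ) =
      ((shiftSign c (y + Pi.single μ 1) : ℤ) : ℂ) * ((shiftSign c y : ℤ) : ℂ) *
        (((staggeredPhase (y + Pi.single μ 1) μ : ℤˣ) : ℤ) : ℂ) := by
  rw [show y + Pi.single μ (1 : ZMod L) + c = (y + c) + Pi.single μ 1 by abel, staggeredPhase_add_single,
    staggeredPhase_add_single, phase_add_eq_shiftSign_mul hL c y μ]
  ring

end Phase

/-! ## 2. `D₀[τ_c U] = P_c (S_c D₀[U] S_c) P_c⁻¹` -/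

section Dirac

variable {ν L N : ℕ} [NeZero L]

omit [NeZero L] in
/-- Translating the base point of a shifted site: `(x + c) + e_μ = (x + e_μ) + c`. [cite: SalmhoferSeiler1991, §2 (2.3)] -/
theorem shift_add_right (x c : TorusSite ν L) (μ : Fin ν) :
    QuantumFieldTheory.Site.shift (x + c) μ = QuantumFieldTheory.Site.shift x μ + c := by
  simp only [QuantumFieldTheory.Site.shift]
  abel

/-- **Entrywise shift covariance of the massless staggered Dirac operator**:
`D₀[τ_c U]_{(x+c,a),(y+c,b)} = ζ_c(x) ζ_c(y) D₀[U]_{(x,a),(y,b)}`. [cite: SalmhoferSeiler1991, §2 (2.3)–(2.4)] -/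
theorem D0_torusConfigShift_apply (hL : Even L) (c : TorusSite ν L) (U : GaugeConfig ν L (OneLink.UN N))
    (x y : TorusSite ν L) (a b : Fin N) :
    D0 (torusConfigShift c U) (x + c, a) (y + c, b) =
      ((shiftSign c x : ℤ) : ℂ) * ((shiftSign c y : ℤ) : ℂ) * D0 U (x, a) (y, b) := by
  have h0 : ∀ P : Prop, ∀ [Decidable P], (if P then ((0 : ℝ) : ℂ) else 0) = 0 := fun P _ => by
    split_ifs <;> simp
  simp only [D0, staggeredDirac, Matrix.of_apply, h0, zero_add, torusConfigShift_apply, add_sub_cancel_right]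
  rw [Finset.mul_sum, Finset.mul_sum, Finset.mul_sum]
  refine Finset.sum_congr rfl fun μ _ => ?_
  have hA : (y + c = QuantumFieldTheory.Site.shift (x + c) μ) ↔ (y = QuantumFieldTheory.Site.shift x μ) := by
    rw [shift_add_right, add_left_inj]
  have hB : (x + c = QuantumFieldTheory.Site.shift (y + c) μ) ↔ (x = QuantumFieldTheory.Site.shift y μ) := by
    rw [shift_add_right, add_left_inj]
  by_cases hxy : y = QuantumFieldTheory.Site.shift x μ
  · -- forward hop present: `η_μ(x + c) = ζ_c(x) ζ_c(y) η_μ(x)` with `y = x + e_μ`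
    have hph : (((staggeredPhase (x + c) μ : ℤˣ) : ℤ) : ℂ) =
        ((shiftSign c x : ℤ) : ℂ) * ((shiftSign c y : ℤ) : ℂ) * (((staggeredPhase x μ : ℤˣ) : ℤ) : ℂ) := by
      rw [hxy]; exact phase_add_eq_shiftSign_mul hL c x μ
    by_cases hyx' : x = QuantumFieldTheory.Site.shift y μ
    · rw [if_pos (hA.2 hxy), if_pos hxy, if_pos (hB.2 hyx'), if_pos hyx', hph]
      ring
    · rw [if_pos (hA.2 hxy), if_pos hxy, if_neg (fun h => hyx' (hB.1 h)), if_neg hyx', hph]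
      ring
  · by_cases hyx' : x = QuantumFieldTheory.Site.shift y μ
    · -- backward hop only: `η_μ(x + c) = ζ_c(x) ζ_c(y) η_μ(x)` with `x = y + e_μ`
      have hph : (((staggeredPhase (x + c) μ : ℤˣ) : ℤ) : ℂ) =
          ((shiftSign c x : ℤ) : ℂ) * ((shiftSign c y : ℤ) : ℂ) * (((staggeredPhase x μ : ℤˣ) : ℤ) : ℂ) := by
        have hxe : x = y + Pi.single μ 1 := hyx'
        rw [hxe]; exact phase_shift_add_eq_shiftSign_mul hL c y μ
      rw [if_neg (fun h => hxy (hA.1 h)), if_neg hxy, if_pos (hB.2 hyx'), if_pos hyx', hph]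
      ring
    · rw [if_neg (fun h => hxy (hA.1 h)), if_neg hxy, if_neg (fun h => hyx' (hB.1 h)), if_neg hyx']
      ring

/-- The relabelling `(x, a) ↦ (x + c, a)` of the colour–site indices. [cite: SalmhoferSeiler1991, §2 (2.3)] -/
abbrev shiftCI (c : TorusSite ν L) : CI ν L N ≃ CI ν L N :=
  (Equiv.addRight c).prodCongr (Equiv.refl (Fin N))

/-- The sign matrix `S_c = diag(ζ_c(x))`. [cite: MontvayMunster1994, §4.3 (4.186)–(4.187)] -/
abbrev signMat (c : TorusSite ν L) : Matrix (CI ν L N) (CI ν L N) ℂ :=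
  Matrix.diagonal fun p => ((shiftSign c p.1 : ℤ) : ℂ)

/-- `S_c² = 1`. [cite: MontvayMunster1994, §4.3 (4.186)–(4.187)] -/
theorem signMat_mul_signMat (c : TorusSite ν L) : signMat (N := N) c * signMat c = 1 := by
  rw [Matrix.diagonal_mul_diagonal, ← Matrix.diagonal_one]
  congr 1
  funext p
  exact cast_shiftSign_mul_self _ _

/-- Entries of a matrix relabelled by `P_c` and conjugated by `S_c`:
`(P_c (S_c M S_c) P_c⁻¹)_{(x',a),(y',b)} = ζ_c(x'-c) M_{(x'-c,a),(y'-c,b)} ζ_c(y'-c)`. [cite: MontvayMunster1994, §4.3 (4.186)–(4.187)] -/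
theorem reindex_signMat_apply (c : TorusSite ν L) (M : Matrix (CI ν L N) (CI ν L N) ℂ) (x' y' : TorusSite ν L)
    (a b : Fin N) :
    Matrix.reindex (shiftCI c) (shiftCI c) (signMat c * M * signMat c) (x', a) (y', b) =
      ((shiftSign c (x' + -c) : ℤ) : ℂ) * M (x' + -c, a) (y' + -c, b) * ((shiftSign c (y' + -c) : ℤ) : ℂ) := by
  have h1 : (shiftCI (N := N) c).symm (x', a) = (x' + -c, a) := rfl
  have h2 : (shiftCI (N := N) c).symm (y', b) = (y' + -c, b) := rfl
  rw [Matrix.reindex_apply, Matrix.submatrix_apply, h1, h2, Matrix.mul_diagonal, Matrix.diagonal_mul]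

/-- **`D₀[τ_c U] = P_c (S_c D₀[U] S_c) P_c⁻¹`** (matrix form of the shift covariance). [cite: SalmhoferSeiler1991, §2 (2.3)–(2.4)] -/
theorem D0_torusConfigShift (hL : Even L) (c : TorusSite ν L) (U : GaugeConfig ν L (OneLink.UN N)) :
    D0 (torusConfigShift c U) = Matrix.reindex (shiftCI c) (shiftCI c) (signMat c * D0 U * signMat c) := by
  ext p q
  obtain ⟨x', a⟩ := p
  obtain ⟨y', b⟩ := q
  rw [reindex_signMat_apply]
  have h := D0_torusConfigShift_apply hL c U (x' + -c) (y' + -c) a b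
  rw [neg_add_cancel_right, neg_add_cancel_right] at h
  rw [h]
  ring

/-- **`det D₀[τ_c U] = det D₀[U]`.** [cite: SalmhoferSeiler1991, §2 (2.11)] -/
theorem det_D0_torusConfigShift (hL : Even L) (c : TorusSite ν L) (U : GaugeConfig ν L (OneLink.UN N)) :
    (D0 (torusConfigShift c U)).det = (D0 U).det := by
  rw [D0_torusConfigShift hL, Matrix.det_reindex_self, Matrix.det_mul, Matrix.det_mul]
  have h1 : (signMat (N := N) c).det * (signMat (N := N) c).det = 1 := by
    rw [← Matrix.det_mul, signMat_mul_signMat, Matrix.det_one]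
  linear_combination (D0 U).det * h1

/-- **`D₀[τ_c U]⁻¹ = P_c (S_c D₀[U]⁻¹ S_c) P_c⁻¹`** (valid also on the singular set, where both sides are
the junk value `0` transported). [cite: SalmhoferSeiler1991, §2 (2.10)–(2.11)] -/
theorem inv_D0_torusConfigShift (hL : Even L) (c : TorusSite ν L) (U : GaugeConfig ν L (OneLink.UN N)) :
    (D0 (torusConfigShift c U))⁻¹ = Matrix.reindex (shiftCI c) (shiftCI c) (signMat c * (D0 U)⁻¹ * signMat c) := by
  have hSinv : (signMat (N := N) c)⁻¹ = signMat c := Matrix.inv_eq_left_inv (signMat_mul_signMat c)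
  rw [D0_torusConfigShift hL, Matrix.inv_reindex, Matrix.mul_inv_rev, Matrix.mul_inv_rev, hSinv, Matrix.mul_assoc]

/-- Entries of the transported propagator: `(D₀[τ_cU]⁻¹)_{(x+c,a),(y+c,b)} = ζ_c(x)ζ_c(y)(D₀[U]⁻¹)_{(x,a),(y,b)}`. [cite: SalmhoferSeiler1991, §2 (2.10)–(2.11)] -/
theorem inv_D0_torusConfigShift_apply (hL : Even L) (c : TorusSite ν L) (U : GaugeConfig ν L (OneLink.UN N))
    (x y : TorusSite ν L) (a b : Fin N) :
    (D0 (torusConfigShift c U))⁻¹ (x + c, a) (y + c, b) =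
      ((shiftSign c x : ℤ) : ℂ) * ((shiftSign c y : ℤ) : ℂ) * (D0 U)⁻¹ (x, a) (y, b) := by
  rw [inv_D0_torusConfigShift hL, reindex_signMat_apply, add_neg_cancel_right, add_neg_cancel_right]
  ring

/-- **The Wick contraction is shift invariant**: `W_{x+c,y+c}(D₀[τ_cU]⁻¹) = W_{xy}(D₀[U]⁻¹)` (the signs
`ζ_c` square away in the colour traces). [cite: SalmhoferSeiler1991, §2 (2.10)–(2.11)] -/
theorem wick2_inv_D0_torusConfigShift (hL : Even L) (c : TorusSite ν L) (U : GaugeConfig ν L (OneLink.UN N))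
    (x y : TorusSite ν L) :
    wick2 (D0 (torusConfigShift c U))⁻¹ (x + c) (y + c) = wick2 (D0 U)⁻¹ x y := by
  set zx := ((shiftSign c x : ℤ) : ℂ) with hzx
  set zy := ((shiftSign c y : ℤ) : ℂ) with hzy
  have hx : zx * zx = 1 := cast_shiftSign_mul_self _ _
  have hy : zy * zy = 1 := cast_shiftSign_mul_self _ _
  unfold wick2
  simp only [inv_D0_torusConfigShift_apply hL, ← hzx, ← hzy]
  have h1 : ∀ g : ℂ, zx * zx * g = g := fun g => by rw [hx, one_mul]
  have h2 : ∀ g : ℂ, zy * zy * g = g := fun g => by rw [hy, one_mul]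
  have h3 : ∀ g g' : ℂ, (zx * zy * g) * (zy * zx * g') = g * g' := fun g g' => by
    calc (zx * zy * g) * (zy * zx * g') = (zx * zx) * (zy * zy) * (g * g') := by ring
      _ = g * g' := by rw [hx, hy, one_mul, one_mul]
  simp only [h1, h2, h3]

end Dirac

/-! ## 3. Translation invariance of the Wilson weight and of the two-point function -/

section Measure

variable {d L N : ℕ} [NeZero L] {G : Type*} [Group G] [TopologicalSpace G] [IsTopologicalGroup G]
  [CompactSpace G] [MeasurableSpace G] [BorelSpace G] (ρ : G →* Matrix (Fin N) (Fin N) ℂ)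

/-- **The Wilson weight `e^{-βS_W} ∏ dU_b` is translation invariant** at every real `β`, for every
compact `G` and representation `ρ` (product Haar measure permuted; the plaquette action is shift
invariant, `wilsonAction_torusConfigShift`). [cite: SalmhoferSeiler1991, §2 (2.2), (2.12)] -/
theorem wilsonWeight_map_torusConfigShift (β : ℝ) (c : Site d L) :
    (wilsonWeight (d := d) (L := L) ρ β).map (torusConfigShift c) = wilsonWeight (d := d) (L := L) ρ β := by
  have hπ : (Measure.pi fun _ : Edge d L => haarProbability G).map (torusConfigShift (G := G) c) =
      Measure.pi fun _ : Edge d L => haarProbability G :=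
    (measurePreserving_arrowCongr' (fun _ : Edge d L => haarProbability G)
      (fun _ : Edge d L => haarProbability G) (torusEdgeShift c) (MeasurableEquiv.refl G)
      fun _ => MeasurePreserving.id _).map_eq
  rw [wilsonWeight, withDensity_map_of_measurableEquiv _ _ _ hπ]
  intro U
  rw [wilsonAction_torusConfigShift]

/-- Change of variables `U ↦ τ_c U` in a Wilson-weighted integral. [cite: SalmhoferSeiler1991, §2 (2.12)] -/
theorem integral_comp_torusConfigShift_wilsonWeight {E : Type*} [NormedAddCommGroup E] [NormedSpace ℝ E]
    (β : ℝ) (c : Site d L) (f : GaugeConfig d L G → E) :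
    ∫ U, f (torusConfigShift c U) ∂(wilsonWeight (d := d) (L := L) ρ β) =
      ∫ U, f U ∂(wilsonWeight (d := d) (L := L) ρ β) := by
  rw [← integral_map_equiv, wilsonWeight_map_torusConfigShift]

end Measure

section TwoPoint

variable {ν L N : ℕ} [NeZero L]

/-- **Translation invariance of the numerator** of the determinant representation at every `β`:
`∫ Re det D₀ · Re W_{x+c,y+c}(D₀⁻¹) d(wilsonWeight ρ β) = ∫ Re det D₀ · Re W_{xy}(D₀⁻¹) d(wilsonWeight ρ β)`. [cite: SalmhoferSeiler1991, (3.100) with §2 (2.10)–(2.12)] -/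
theorem detRep_numerator_add (hL : Even L) (β : ℝ) (x y c : TorusSite ν L) :
    ∫ U, ((D0 U).det).re * (wick2 (D0 U)⁻¹ (x + c) (y + c)).re
        ∂(wilsonWeight (d := ν) (L := L) (unitaryFundamentalRep (Fin N) ℂ) β) =
      ∫ U, ((D0 U).det).re * (wick2 (D0 U)⁻¹ x y).re
        ∂(wilsonWeight (d := ν) (L := L) (unitaryFundamentalRep (Fin N) ℂ) β) := by
  rw [← integral_comp_torusConfigShift_wilsonWeight (unitaryFundamentalRep (Fin N) ℂ) β c
    (fun U => ((D0 U).det).re * (wick2 (D0 U)⁻¹ (x + c) (y + c)).re)]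
  refine integral_congr_ae (ae_of_all _ fun U => ?_)
  dsimp only
  rw [det_D0_torusConfigShift hL, wick2_inv_D0_torusConfigShift hL]

/-- The Wick contraction is symmetric in the two sites. [cite: SalmhoferSeiler1991, §2 (2.10)–(2.11)] -/
theorem wick2_comm {Λ : Type*} (G : Matrix (Λ × Fin N) (Λ × Fin N) ℂ) (x y : Λ) : wick2 G x y = wick2 G y x := by
  unfold wick2
  rw [mul_comm, Finset.sum_comm]
  congr 1
  exact Finset.sum_congr rfl fun b _ => Finset.sum_congr rfl fun a _ => mul_comm _ _

/-- **The determinant representation of the massless two-point function is translation invariant at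
every coupling**: `T_β(x + c, y + c) = T_β(x, y)` for
`T_β(x,y) = (∫ Re det D₀ · Re W_{xy}(D₀⁻¹) d(wilsonWeight ρ β)) / (∫ Re det D₀ d(wilsonWeight ρ β))`
(`G = U(N)`, periodic even torus, every real `β`). [cite: SalmhoferSeiler1991, (3.100) with §2 (2.10)–(2.12)] -/
theorem detRep_twoPoint_add (hL : Even L) (β : ℝ) (x y c : TorusSite ν L) :
    (∫ U, ((D0 U).det).re * (wick2 (D0 U)⁻¹ (x + c) (y + c)).re
        ∂(wilsonWeight (d := ν) (L := L) (unitaryFundamentalRep (Fin N) ℂ) β)) /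
      (∫ U, ((D0 U).det).re ∂(wilsonWeight (d := ν) (L := L) (unitaryFundamentalRep (Fin N) ℂ) β)) =
    (∫ U, ((D0 U).det).re * (wick2 (D0 U)⁻¹ x y).re
        ∂(wilsonWeight (d := ν) (L := L) (unitaryFundamentalRep (Fin N) ℂ) β)) /
      (∫ U, ((D0 U).det).re ∂(wilsonWeight (d := ν) (L := L) (unitaryFundamentalRep (Fin N) ℂ) β)) := by
  rw [detRep_numerator_add hL]

/-- **The determinant representation of the two-point function is symmetric**: `T_β(x, y) = T_β(y, x)`. [cite: SalmhoferSeiler1991, (3.100) with §2 (2.10)–(2.11)] -/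
theorem detRep_twoPoint_comm (β : ℝ) (x y : TorusSite ν L) :
    (∫ U, ((D0 U).det).re * (wick2 (D0 U)⁻¹ x y).re
        ∂(wilsonWeight (d := ν) (L := L) (unitaryFundamentalRep (Fin N) ℂ) β)) /
      (∫ U, ((D0 U).det).re ∂(wilsonWeight (d := ν) (L := L) (unitaryFundamentalRep (Fin N) ℂ) β)) =
    (∫ U, ((D0 U).det).re * (wick2 (D0 U)⁻¹ y x).re
        ∂(wilsonWeight (d := ν) (L := L) (unitaryFundamentalRep (Fin N) ℂ) β)) /
      (∫ U, ((D0 U).det).re ∂(wilsonWeight (d := ν) (L := L) (unitaryFundamentalRep (Fin N) ℂ) β)) := by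
  simp_rw [wick2_comm _ x y]

end TwoPoint

end StaggeredShift

end Literature.MathematicalPhysics.QuantumLattice

end
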